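import Literature.Topology.FourManifolds.TautFoliationsCollarRings
import Literature.Topology.FourManifolds.TautFoliationsLevelCircles
import HarnessLib

/-!
# The wiggly ring is plaque-invariant: leaves of the contour foliation through it stay in it

Topic: the coned fence collar (C4c, first half). For a cone position `P` of the collar disc
with fine mesh keeping the disc map on the outer-collar edges and a radius `R ≥ 15L/16`, the
wiggly ring `W_R` (`TautFoliationsCollarRings`) is invariant under the plaques of the contour
foliation: a plaque of an atlas chart through a point of `W_R` lies in `W_R`
(`plaque_subset_wigglyRing`), hence **the leaf of the contour foliation through a point of `W_R`
lies in `W_R`** (`leaf_subset_wigglyRing`). On an open square a plane chart height is the cone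
height (`roofChart_snd`, `floorChart_snd`), so a plaque through a point of the contour arc of
`Q` stays in it; an edge chart between the roof square `Q₁` and the floor square `Q₂` reads
the canonical glued height (`EdgeDataAt.chart_snd_eq_canonHt`): the cone height of `Q₁` on the
closed square of `Q₁` and the converted cone height `σ ∘ H_{Q₂}` beyond; a connected plaque
crossing the edge contains an edge point, which is a ring point (the contour arcs meet the edge
only on the ring), where the compatibility `ψ₁ = σ ∘ ψ₂` identifies the two levels
`radialHt Q₁ R = σ (radialHt Q₂ R)`.

* `ConePosition.plaque_subset_wigglyRing`, `ConePosition.leaf_subset_wigglyRing` (**proved**).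

All statements are [folklore].
-/

noncomputable section

open Set Filter Metric Topology Function Real
open scoped unitInterval
open Literature.Topology.PlanarFoliations

namespace Literature.Topology.FourManifolds

namespace Foliation.ConePosition

open SquareGrid SquareGrid.Grid SquarePolar ConeSquare CollarRadius

variable {B : Type*} [NormedAddCommGroup B] [NormedSpace ℝ B] {M : Type*} [TopologicalSpace M] {F : Foliation B M}
variable {Γ : C(I, F.GermSpace)} {τ₀ ε : ℝ} {Φ : I → ℝ → M} {c₀ : ℝ × ℝ} {L : ℝ} {hL : 0 < L} {G : ℝ × ℝ → M}
variable (P : ConePosition F G c₀ hL)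

variable (hΦ : IsFenceOn F Γ τ₀ ε Φ univ) (hcl : ∀ τ ∈ Ioo (τ₀ - ε) (τ₀ + ε), Φ 1 τ = Φ 0 τ) {τ₁ : ℝ}
  (hτI : uIcc τ₀ τ₁ ⊆ Ioo (τ₀ - ε) (τ₀ + ε)) (h01 : τ₁ ≠ τ₀)
  (hG : ∀ x, L / 2 ≤ dist x c₀ → G x = Φ (angleParam c₀ x) (levelOfParam τ₀ τ₁ (1 - dist x c₀ / L)))
  (hGc : Continuous G) (hn32 : 32 ≤ P.n)
  (hskelT : ∀ q k, P.gr.edge q k '' Icc 0 (2 * P.gr.ℓ) ⊆ {x | 7 * L / 8 ≤ dist x c₀} →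
    ∀ s ∈ Icc 0 (2 * P.gr.ℓ), P.skel (P.gr.edge q k s) = G (P.gr.edge q k s))
  {R : ℝ} (hR : 15 * L / 16 ≤ R)

include hΦ hcl hτI h01 hG hGc hn32 hskelT hR in
omit [NormedSpace ℝ B] in
/-- A boundary point of a square meeting the ring, at the radial level, is a ring point.
[folklore] -/
theorem dist_eq_of_mem_ringLevel_of_mem_sphere {q : Fin P.n × Fin P.n} (hqR : (P.gr.sq q ∩ sphere c₀ R).Nonempty)
    {y : ℝ × ℝ} (hy : y ∈ P.ringLevel q R) (hys : y ∈ sphere (P.gr.centre q) P.gr.ℓ) : dist y c₀ = R := by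
  have h : y ∈ P.ringLevel q R ∩ sphere (P.gr.centre q) P.gr.ℓ := ⟨hy, hys⟩
  rw [P.ringLevel_inter_sphere hΦ hcl hτI h01 hG hGc hn32 hskelT hR hqR] at h
  exact mem_sphere.1 h.2

include hΦ hcl hτI h01 hG hGc hn32 hskelT hR in
omit [NormedSpace ℝ B] in
/-- At a ring point of the boundary of a square the boundary height is the radial height.
[folklore] -/
theorem bdryHt_eq_radialHt {q : Fin P.n × Fin P.n} {y : ℝ × ℝ} (hys : y ∈ sphere (P.gr.centre q) P.gr.ℓ)
    (hyR : dist y c₀ = R) : P.bdryHt q y = P.radialHt q R := by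
  have hqR : (P.gr.sq q ∩ sphere c₀ R).Nonempty := ⟨y, P.gr.sphere_subset_sq q hys, mem_sphere.2 hyR⟩
  rw [(P.isRadial_of_ring hΦ hcl hτI h01 hG hGc hn32 hskelT hR hqR).eq y hys, hyR]

include hΦ hcl hτI h01 hG hGc hn32 hskelT hR in
/-- A ring point of the boundary of a square lies on the contour arc of that square. [folklore] -/
theorem mem_ringLevel_of_mem_sphere (ho : F.IsTransverselyOriented) {q : Fin P.n × Fin P.n} {y : ℝ × ℝ}
    (hys : y ∈ sphere (P.gr.centre q) P.gr.ℓ) (hyR : dist y c₀ = R) : y ∈ P.ringLevel q R := by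
  refine ⟨P.gr.sphere_subset_sq q hys, ?_⟩
  show (P.datum ho).H q y = P.radialHt q R
  rw [CheckerboardDatum.H, datum_m, datum_ψ, coneHt_of_mem_sphere P.gr.hℓ hys]
  exact P.bdryHt_eq_radialHt hΦ hcl hτI h01 hG hGc hn32 hskelT hR hys hyR

include hΦ hcl hτI h01 hG hGc hn32 hskelT hR in
/-- **Plaque invariance of the wiggly ring.** [folklore] -/
theorem plaque_subset_wigglyRing (ho : F.IsTransverselyOriented) {e : OpenPartialHomeomorph P.gr.X₀ (ℝ × ℝ)}
    (he : e ∈ (P.datum ho).foliation.atlas) {z w : P.gr.X₀} (hz : (z : ℝ × ℝ) ∈ P.wigglyRing R)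
    (hze : z ∈ e.source) (hwe : w ∈ e.source) (hzw : (e z).2 = (e w).2) : (w : ℝ × ℝ) ∈ P.wigglyRing R := by
  classical
  haveI := P.gr.nonempty_X₀
  have hℓ := P.gr.hℓ
  obtain ⟨c, ⟨ĉ, hĉ, rfl⟩, p, r, hrr, hbox, rfl⟩ := he
  -- the (connected) plaque through `z`
  set Pl := {v : P.gr.X₀ | v ∈ (renormBox (ĉ.subtypeRestr P.gr.nonempty_X₀) p r hrr).source ∧
    (renormBox (ĉ.subtypeRestr P.gr.nonempty_X₀) p r hrr v).2 = (renormBox (ĉ.subtypeRestr P.gr.nonempty_X₀) p r hrr z).2} with hPl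
  have hPlc : IsConnected Pl := PreAtlas.isConnected_plaque hbox hze
  have hwPl : w ∈ Pl := ⟨hwe, hzw.symm⟩
  have hzPl : z ∈ Pl := ⟨hze, rfl⟩
  have hht : ∀ v ∈ Pl, (ĉ v).2 = (ĉ z).2 := fun v hv ↦ (renormBox_snd_eq_iff hv.1 hze).1 hv.2
  have hsrc : ∀ v ∈ Pl, (v : ℝ × ℝ) ∈ ĉ.source := fun v hv ↦ by
    have := renormBox_source_subset _ _ _ _ hv.1
    rwa [OpenPartialHomeomorph.subtypeRestr_source] at this
  -- the square `q₀` of `z`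
  obtain ⟨q₀, hq₀R, hz₀⟩ := mem_iUnion₂.1 hz
  have hz₀' : (z : ℝ × ℝ) ∈ P.gr.sq q₀ ∧ (P.datum ho).H q₀ z = P.radialHt q₀ R := hz₀
  -- it suffices to put every point of the plaque in `W_R`
  suffices H : ∀ v ∈ Pl, (v : ℝ × ℝ) ∈ P.wigglyRing R from H w hwPl
  -- a point of the contour arc of `q` in the open square of `q₁` forces `q = q₁`
  have key_ball : ∀ {q q₁ : Fin P.n × Fin P.n} {y : ℝ × ℝ}, y ∈ P.gr.sq q → y ∈ ball (P.gr.centre q₁) P.gr.ℓ → q = q₁ := by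
    intro q q₁ y hy hyb
    by_contra hne
    exact disjoint_left.1 (P.gr.ball_disjoint_sq (Ne.symm hne)) hyb hy
  rcases hĉ with ⟨q₁, h₁, k, rfl⟩ | ⟨q₁, h₁, k, rfl⟩ | ⟨q₁, q₂, T, hn, hr₁, hf₂, E, rfl⟩
  · -- roof chart of `q₁`: the plaque stays in the open square, heights are cone heights of `q₁`
    have hzb : (z : ℝ × ℝ) ∈ ball (P.gr.centre q₁) P.gr.ℓ := (P.datum ho).roofChart_source_subset h₁ k (hsrc z hzPl)
    have hq : q₀ = q₁ := key_ball hz₀'.1 hzb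
    subst hq
    intro v hv
    have hvb : (v : ℝ × ℝ) ∈ ball (P.gr.centre q₀) P.gr.ℓ := (P.datum ho).roofChart_source_subset h₁ k (hsrc v hv)
    refine mem_iUnion₂.2 ⟨q₀, hq₀R, ball_subset_closedBall hvb, ?_⟩
    show (P.datum ho).H q₀ v = P.radialHt q₀ R
    rw [← hz₀'.2, ← (P.datum ho).roofChart_snd h₁ k, ← (P.datum ho).roofChart_snd h₁ k]
    exact hht v hv
  · -- floor chart
    have hzb : (z : ℝ × ℝ) ∈ ball (P.gr.centre q₁) P.gr.ℓ := (P.datum ho).floorChart_source_subset h₁ k (hsrc z hzPl)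
    have hq : q₀ = q₁ := key_ball hz₀'.1 hzb
    subst hq
    intro v hv
    have hvb : (v : ℝ × ℝ) ∈ ball (P.gr.centre q₀) P.gr.ℓ := (P.datum ho).floorChart_source_subset h₁ k (hsrc v hv)
    refine mem_iUnion₂.2 ⟨q₀, hq₀R, ball_subset_closedBall hvb, ?_⟩
    show (P.datum ho).H q₀ v = P.radialHt q₀ R
    rw [← hz₀'.2, ← (P.datum ho).floorChart_snd h₁ k, ← (P.datum ho).floorChart_snd h₁ k]
    exact hht v hv
  · -- edge chart between the roof `q₁` and the floor `q₂`
    set a := P.gr.centre q₁ with ha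
    set b := P.gr.centre q₂ with hb
    set hstar := (E.chart z).2 with hhstar
    -- the canonical glued height on the plaque
    have hcanon : ∀ v ∈ Pl, (if dist (v : ℝ × ℝ) a ≤ P.gr.ℓ then (P.datum ho).H q₁ v else ((P.datum ho).σ q₁ q₂) ((P.datum ho).H q₂ v)) = hstar := fun v hv ↦ by
      have h := E.chart_snd_eq_canonHt (hsrc v hv)
      rw [hht v hv] at h
      exact h.symm
    -- sides: beyond the closed square of `q₁` the points are in the open square of `q₂`
    have hside₂ : ∀ v ∈ Pl, P.gr.ℓ < dist (v : ℝ × ℝ) a → (v : ℝ × ℝ) ∈ ball b P.gr.ℓ := fun v hv hlt ↦ by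
      rcases E.source_subset (hsrc v hv) with (hb' | hb') | hedge
      · exact absurd (mem_ball.1 hb') (not_lt.2 hlt.le)
      · exact hb'
      · exact absurd (mem_sphere.1 hedge.1) (ne_of_gt hlt)
    -- an edge point of the plaque is a ring point iff its `q₁`-level is the radial one; key relations
    -- (1) if the plaque has a point in the closed square of `q₁` at the radial level of `q₁`, and `q₁` meets the ring:
    --     `hstar = radialHt q₁ R`
    -- We derive the two level identities from the position of `z`.
    have hzsrc := hsrc z hzPl
    -- the two relations, obtained through an edge point of the plaque at radius `R`
    have hrel_of_edgePt : ∀ v₀ ∈ Pl, (v₀ : ℝ × ℝ) ∈ openEdge a b P.gr.ℓ → dist (v₀ : ℝ × ℝ) c₀ = R →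
        hstar = P.radialHt q₁ R ∧ hstar = ((P.datum ho).σ q₁ q₂) (P.radialHt q₂ R) ∧
        (P.gr.sq q₁ ∩ sphere c₀ R).Nonempty ∧ (P.gr.sq q₂ ∩ sphere c₀ R).Nonempty := by
      intro v₀ hv₀ hedge hv₀R
      have hs₁ : (v₀ : ℝ × ℝ) ∈ sphere a P.gr.ℓ := hedge.1
      have hs₂ : (v₀ : ℝ × ℝ) ∈ sphere b P.gr.ℓ := hedge.2.1
      have hq₁R : (P.gr.sq q₁ ∩ sphere c₀ R).Nonempty := ⟨v₀, P.gr.sphere_subset_sq q₁ hs₁, mem_sphere.2 hv₀R⟩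
      have hq₂R : (P.gr.sq q₂ ∩ sphere c₀ R).Nonempty := ⟨v₀, P.gr.sphere_subset_sq q₂ hs₂, mem_sphere.2 hv₀R⟩
      have h1 : hstar = (P.datum ho).H q₁ v₀ := by
        have h := hcanon v₀ hv₀
        rw [if_pos (mem_sphere.1 hs₁).le] at h
        exact h.symm
      have hH₁ : (P.datum ho).H q₁ v₀ = P.bdryHt q₁ v₀ := by
        show coneHt (P.gr.centre q₁) P.gr.ℓ ((P.datum ho).m q₁) ((P.datum ho).ψ q₁) v₀ = _
        rw [coneHt_of_mem_sphere hℓ hs₁]; rfl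
      have hψ₁ : P.bdryHt q₁ v₀ = P.radialHt q₁ R := P.bdryHt_eq_radialHt hΦ hcl hτI h01 hG hGc hn32 hskelT hR hs₁ hv₀R
      have hψ₂ : P.bdryHt q₂ v₀ = P.radialHt q₂ R := P.bdryHt_eq_radialHt hΦ hcl hτI h01 hG hGc hn32 hskelT hR hs₂ hv₀R
      have hcompat : (P.datum ho).ψ q₁ v₀ = ((P.datum ho).σ q₁ q₂) ((P.datum ho).ψ q₂ v₀) := E.compat v₀ ⟨hs₁, hs₂⟩
      refine ⟨by rw [h1, hH₁, hψ₁], ?_, hq₁R, hq₂R⟩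
      rw [h1, hH₁, ← hψ₂]
      exact hcompat
    -- an edge point of the plaque exists as soon as the plaque has points on both sides
    have hexists_edgePt : (∃ v ∈ Pl, dist (v : ℝ × ℝ) a ≤ P.gr.ℓ) → (∃ v ∈ Pl, P.gr.ℓ < dist (v : ℝ × ℝ) a) →
        ∃ v₀ ∈ Pl, (v₀ : ℝ × ℝ) ∈ openEdge a b P.gr.ℓ := by
      rintro ⟨v₁, hv₁, hd₁⟩ ⟨v₂, hv₂, hd₂⟩
      -- intermediate value of `v ↦ dist v a` on the connected plaque
      have hcont : Continuous fun v : P.gr.X₀ ↦ dist (v : ℝ × ℝ) a := continuous_subtype_val.dist continuous_const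
      obtain ⟨v₀, hv₀, hv₀d⟩ : ∃ v₀ ∈ Pl, dist (v₀ : ℝ × ℝ) a = P.gr.ℓ :=
        hPlc.isPreconnected.intermediate_value hv₁ hv₂ hcont.continuousOn ⟨hd₁, hd₂.le⟩
      refine ⟨v₀, hv₀, ?_⟩
      rcases E.source_subset (hsrc v₀ hv₀) with (hb' | hb') | hedge
      · exact absurd (mem_ball.1 hb') (by rw [hv₀d]; exact lt_irrefl _)
      · -- in the open square of `q₂` but on the sphere of `q₁`: impossible
        exfalso
        have hne : q₂ ≠ q₁ := fun h ↦ hf₂ (h ▸ hr₁)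
        exact disjoint_left.1 (P.gr.ball_disjoint_sq hne) hb' (P.gr.sphere_subset_sq q₁ (mem_sphere.2 hv₀d))
      · exact hedge
    -- the position of `z`: in `ball a`, in `ball b`, or on the open edge
    have hfinal : ∀ v ∈ Pl, (v : ℝ × ℝ) ∈ P.wigglyRing R := by
      -- first establish: every `q₁`-side point is on the arc of `q₁` and every `q₂`-side point on the arc of `q₂`
      -- via the level identities, which we now derive
      have hids : (∀ v ∈ Pl, dist (v : ℝ × ℝ) a ≤ P.gr.ℓ → hstar = P.radialHt q₁ R ∧ (P.gr.sq q₁ ∩ sphere c₀ R).Nonempty) ∧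
          (∀ v ∈ Pl, P.gr.ℓ < dist (v : ℝ × ℝ) a → hstar = ((P.datum ho).σ q₁ q₂) (P.radialHt q₂ R) ∧ (P.gr.sq q₂ ∩ sphere c₀ R).Nonempty) := by
        rcases E.source_subset hzsrc with (hzb | hzb) | hzedge
        · -- `z` in the open square of `q₁`: `q₀ = q₁`, `hstar = H q₁ z = radialHt q₁ R`
          have hq : q₀ = q₁ := key_ball hz₀'.1 hzb
          have hstar₁ : hstar = P.radialHt q₁ R := by
            rw [hhstar, E.chart_snd_of_mem_ball_left hzb, ← hq]; exact hz₀'.2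
          have hq₁R : (P.gr.sq q₁ ∩ sphere c₀ R).Nonempty := hq ▸ hq₀R
          refine ⟨fun v hv _ ↦ ⟨hstar₁, hq₁R⟩, fun v hv hvd ↦ ?_⟩
          -- a point beyond: cross the edge
          obtain ⟨v₀, hv₀, hedge⟩ := hexists_edgePt ⟨z, hzPl, (mem_ball.1 hzb).le⟩ ⟨v, hv, hvd⟩
          -- `v₀` is a ring point: its `q₁`-level is `hstar = radialHt q₁ R`
          have hv₀R : dist (v₀ : ℝ × ℝ) c₀ = R := by
            refine P.dist_eq_of_mem_ringLevel_of_mem_sphere hΦ hcl hτI h01 hG hGc hn32 hskelT hR hq₁R ⟨P.gr.sphere_subset_sq q₁ hedge.1, ?_⟩ hedge.1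
            show (P.datum ho).H q₁ v₀ = P.radialHt q₁ R
            have h := hcanon v₀ hv₀
            rw [if_pos (mem_sphere.1 hedge.1).le] at h
            rw [h, hstar₁]
          obtain ⟨-, h2, -, hq₂R⟩ := hrel_of_edgePt v₀ hv₀ hedge hv₀R
          exact ⟨h2, hq₂R⟩
        · -- `z` in the open square of `q₂`
          have hq : q₀ = q₂ := key_ball hz₀'.1 hzb
          have hstar₂ : hstar = ((P.datum ho).σ q₁ q₂) (P.radialHt q₂ R) := by
            rw [hhstar, E.chart_snd_of_mem_ball_right hzb, ← hq]
            exact congrArg _ hz₀'.2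
          have hq₂R : (P.gr.sq q₂ ∩ sphere c₀ R).Nonempty := hq ▸ hq₀R
          refine ⟨fun v hv hvd ↦ ?_, fun v hv _ ↦ ⟨hstar₂, hq₂R⟩⟩
          have hzd : P.gr.ℓ < dist (z : ℝ × ℝ) a := by
            by_contra hle
            push Not at hle
            have hne : q₂ ≠ q₁ := fun h ↦ hf₂ (h ▸ hr₁)
            exact disjoint_left.1 (P.gr.ball_disjoint_sq hne) hzb (mem_closedBall.2 hle)
          obtain ⟨v₀, hv₀, hedge⟩ := hexists_edgePt ⟨v, hv, hvd⟩ ⟨z, hzPl, hzd⟩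
          have hv₀R : dist (v₀ : ℝ × ℝ) c₀ = R := by
            refine P.dist_eq_of_mem_ringLevel_of_mem_sphere hΦ hcl hτI h01 hG hGc hn32 hskelT hR hq₂R ⟨P.gr.sphere_subset_sq q₂ hedge.2.1, ?_⟩ hedge.2.1
            show (P.datum ho).H q₂ v₀ = P.radialHt q₂ R
            -- `H q₂ v₀ = ψ₂ v₀` and `ψ₁ v₀ = σ (ψ₂ v₀)`, `H q₁ v₀ = ψ₁ v₀ = hstar = σ (radialHt q₂ R)`
            have h := hcanon v₀ hv₀
            rw [if_pos (mem_sphere.1 hedge.1).le] at h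
            have hH₁ : (P.datum ho).H q₁ v₀ = (P.datum ho).ψ q₁ v₀ := by
              show coneHt (P.gr.centre q₁) P.gr.ℓ ((P.datum ho).m q₁) ((P.datum ho).ψ q₁) v₀ = _; rw [coneHt_of_mem_sphere hℓ hedge.1]
            have hH₂ : (P.datum ho).H q₂ v₀ = (P.datum ho).ψ q₂ v₀ := by
              show coneHt (P.gr.centre q₂) P.gr.ℓ ((P.datum ho).m q₂) ((P.datum ho).ψ q₂) v₀ = _; rw [coneHt_of_mem_sphere hℓ hedge.2.1]
            have hcompat : (P.datum ho).ψ q₁ v₀ = ((P.datum ho).σ q₁ q₂) ((P.datum ho).ψ q₂ v₀) := E.compat v₀ ⟨hedge.1, hedge.2.1⟩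
            rw [hH₂]
            apply ((P.datum ho).σ q₁ q₂).injective
            rw [← hcompat, ← hH₁, h, hstar₂]
          obtain ⟨h1, -, hq₁R, -⟩ := hrel_of_edgePt v₀ hv₀ hedge hv₀R
          exact ⟨h1, hq₁R⟩
        · -- `z` on the open edge: it is a boundary point of `q₀` at the radial level, hence a ring point
          have hzs₀ : (z : ℝ × ℝ) ∈ sphere (P.gr.centre q₀) P.gr.ℓ := by
            rcases (mem_closedBall.1 hz₀'.1).lt_or_eq with hlt | heq
            · exact absurd (mem_ball.2 hlt) (P.gr.not_mem_ball_of_mem_openEdge hzedge)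
            · exact mem_sphere.2 heq
          have hzR : dist (z : ℝ × ℝ) c₀ = R :=
            P.dist_eq_of_mem_ringLevel_of_mem_sphere hΦ hcl hτI h01 hG hGc hn32 hskelT hR hq₀R hz₀ hzs₀
          obtain ⟨h1, h2, hq₁R, hq₂R⟩ := hrel_of_edgePt z hzPl hzedge hzR
          exact ⟨fun v _ _ ↦ ⟨h1, hq₁R⟩, fun v _ _ ↦ ⟨h2, hq₂R⟩⟩
      intro v hv
      by_cases hvd : dist (v : ℝ × ℝ) a ≤ P.gr.ℓ
      · obtain ⟨hstar₁, hq₁R⟩ := hids.1 v hv hvd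
        refine mem_iUnion₂.2 ⟨q₁, hq₁R, mem_closedBall.2 hvd, ?_⟩
        show (P.datum ho).H q₁ v = P.radialHt q₁ R
        have h := hcanon v hv
        rw [if_pos hvd] at h
        rw [h, hstar₁]
      · push Not at hvd
        obtain ⟨hstar₂, hq₂R⟩ := hids.2 v hv hvd
        refine mem_iUnion₂.2 ⟨q₂, hq₂R, ball_subset_closedBall (hside₂ v hv hvd), ?_⟩
        show (P.datum ho).H q₂ v = P.radialHt q₂ R
        have h := hcanon v hv
        rw [if_neg (not_le.2 hvd)] at h
        exact ((P.datum ho).σ q₁ q₂).injective (h.trans hstar₂)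
    exact hfinal

include hΦ hcl hτI h01 hG hGc hn32 hskelT hR in
/-- **The leaf of the contour foliation through a point of the wiggly ring lies in the wiggly
ring.** [folklore] -/
theorem leaf_subset_wigglyRing (ho : F.IsTransverselyOriented) {y : P.gr.X₀} (hy : (y : ℝ × ℝ) ∈ P.wigglyRing R) :
    ∀ z ∈ (P.contourFol ho).leaf y, (z : ℝ × ℝ) ∈ P.wigglyRing R := by
  intro z hz
  rw [contourFol, leaf_biOrient] at hz
  have h := (P.datum ho).foliation.leaf_subset_of_plaque_invariant (S := ((↑) : P.gr.X₀ → ℝ × ℝ) ⁻¹' P.wigglyRing R)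
    (fun e he z' hz' w hze hwe hh ↦ P.plaque_subset_wigglyRing hΦ hcl hτI h01 hG hGc hn32 hskelT hR ho he hz' hze hwe hh) hy
  exact h hz

end Foliation.ConePosition

end Literature.Topology.FourManifolds
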